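import Summits.CriticalPhenomena.PercolationContinuityZ3.Theorems.SoloInformedSlabBoxFace
import HarnessLib

/-!
# The cube lemma: every lattice path of extent `m` crosses a cube of side `m` (solo seat
`solo-CriticalPhenomena-informed`, paper §7b.3 (d6), toolbox for `SoloInformedCubeFace`)

A purely combinatorial fact about nearest-neighbour paths in `ℤ^d`, and its percolation
packaging.

**Window lemma** (`exists_window`).  Let `W = (w_0, …, w_L)` be a nearest-neighbour path whose
`k`-th coordinate increases by at least `m ≥ 1` from `w_0` to `w_L`.  Among the index windows
`[i, i+n]` on which SOME coordinate of SOME two vertices differs by at least `m`, take one of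
minimal length `n`.  Then on that window EVERY coordinate of every two vertices differs by at
most `m`: the two sub-windows `[i+1, i+n]`, `[i, i+n-1]` have all differences `< m` by
minimality, and the only remaining pair `{i, i+n}` is one lattice step plus a pair of
`[i+1, i+n]`.  Consequently (`exists_cubeCross_of_walk`) the vertices `w_i, …, w_{i+n}` lie in
a cube `a₀ + [0, m]^d` and two of them lie on OPPOSITE faces `{x_{k'} = a₀_{k'}}`,
`{x_{k'} = a₀_{k'} + m}` of that cube, joined by the sub-path between them, which stays in the
cube: **a lattice path of extent `≥ m` crosses some cube of side `m` from a face to the opposite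
face, inside the cube.**  (The direction `k'` is the coordinate that first accumulates range `m`;
it need not be `k`.  The statement fails for boxes elongated in the crossing direction: the
staircase `+e₁, +e₂, +e₁, +e₂, …` crosses no box `[0,(1+ε)m] × [0,m] × …` in its long direction.)

This is the geometric input of the cube face (`SoloInformedCubeFace`): an open path across the
annulus `Λ(2m) ∖ Λ(m)` crosses, face to opposite face, a cube of side `m` inside `Λ(2m)`, so that
Harris' inequality over a BOUNDED family of near-cubes bounds the annulus-crossing probability
by the crossing probability of one near-cube.  Elementary. [folklore]
-/

noncomputable section

namespace Summit.CriticalPhenomena.PercolationContinuityZ3.Theorems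

open MeasureTheory ProbabilityTheory Filter Topology
open Literature.Probability.Percolation Literature.Probability.LatticeModels
open Literature.Probability.Percolation.CerfDembinVanishing
open scoped ENNReal

namespace SurfaceTension

variable {d : ℕ}

/-! ## Vertices and sub-walks of a walk -/

/-- A walk in a graph of steps inside `R` that starts in `R` stays in `R`. -/
theorem getVert_mem_of_le_withinGraph {V : Type*} {G H : SimpleGraph V} {R : Set V}
    (hH : H ≤ withinGraph G R) :
    ∀ {u v : V} (W : H.Walk u v), u ∈ R → ∀ r : ℕ, W.getVert r ∈ R := by
  intro u v W
  induction W with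
  | nil => intro hu r; simpa using hu
  | @cons a c _ hac W ih =>
    intro _ r
    cases r with
    | zero => simpa
    | succ r =>
      rw [SimpleGraph.Walk.getVert_cons_succ]
      exact ih (withinGraph_adj.1 (hH hac)).2.2 r

/-- Consecutive vertices `w_s, …, w_{s+k}` of a walk, all lying in `C`, are joined inside `C`. -/
theorem reachable_getVert_of_forall_mem {V : Type*} {G H : SimpleGraph V} (hH : H ≤ G)
    {u v : V} (W : H.Walk u v) (C : Set V) (s : ℕ) :
    ∀ k : ℕ, s + k ≤ W.length → (∀ r, s ≤ r → r ≤ s + k → W.getVert r ∈ C) →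
      (H ⊓ withinGraph G C).Reachable (W.getVert s) (W.getVert (s + k)) := by
  intro k
  induction k with
  | zero => intro _ _; exact SimpleGraph.Reachable.refl _
  | succ k ih =>
    intro hk hC
    have h1 := ih (by omega) fun r hr1 hr2 => hC r hr1 (by omega)
    have hadj : H.Adj (W.getVert (s + k)) (W.getVert (s + k + 1)) :=
      W.adj_getVert_succ (by omega)
    have h2 : (H ⊓ withinGraph G C).Adj (W.getVert (s + k)) (W.getVert (s + (k + 1))) := by
      rw [← Nat.add_assoc, SimpleGraph.inf_adj, withinGraph_adj]
      exact ⟨hadj, hH hadj, hC _ (by omega) (by omega), hC _ (by omega) (by omega)⟩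
    exact h1.trans h2.reachable

/-! ## The window lemma -/

/-- **Window lemma.** A nearest-neighbour walk whose `k`-th coordinate increases by at least
`m ≥ 1` has an index window `[i, i+n]` (`n ≥ 1`) on which all coordinates of all pairs of vertices
differ by at most `m`, and some coordinate of some pair differs by at least (hence exactly) `m`. -/
theorem exists_window {H : SimpleGraph (Site d)} (hH : H ≤ zdGraph d) {u v : Site d}
    (W : H.Walk u v) {m : ℕ} (hm : 1 ≤ m) {k : Fin d} (hk : (m : ℤ) ≤ v k - u k) :
    ∃ i n : ℕ, 1 ≤ n ∧ i + n ≤ W.length ∧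
      (∀ s t : ℕ, i ≤ s → s ≤ i + n → i ≤ t → t ≤ i + n → ∀ j : Fin d,
        W.getVert t j - W.getVert s j ≤ m) ∧
      ∃ (j : Fin d) (s t : ℕ), i ≤ s ∧ s ≤ i + n ∧ i ≤ t ∧ t ≤ i + n ∧
        (m : ℤ) ≤ W.getVert t j - W.getVert s j := by
  classical
  -- windows `[i, i+n]` carrying a difference `≥ m`
  have hex : ∃ n : ℕ, ∃ i : ℕ, i + n ≤ W.length ∧ ∃ (j : Fin d) (s t : ℕ),
      i ≤ s ∧ s ≤ i + n ∧ i ≤ t ∧ t ≤ i + n ∧ (m : ℤ) ≤ W.getVert t j - W.getVert s j :=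
    ⟨W.length, 0, by simp, k, 0, W.length, le_rfl, by simp, by simp, by simp,
      by simpa only [SimpleGraph.Walk.getVert_zero, SimpleGraph.Walk.getVert_length] using hk⟩
  obtain ⟨i, hi, j, s, t, hs1, hs2, ht1, ht2, hst⟩ := Nat.find_spec hex
  have hmin : ∀ n, n < Nat.find hex → ¬ ∃ i : ℕ, i + n ≤ W.length ∧ ∃ (j : Fin d) (s t : ℕ),
      i ≤ s ∧ s ≤ i + n ∧ i ≤ t ∧ t ≤ i + n ∧ (m : ℤ) ≤ W.getVert t j - W.getVert s j :=
    fun n hn => Nat.find_min hex hn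
  set n₀ := Nat.find hex with hn₀def
  -- a window of length `0` carries no difference `≥ 1`
  have hn₀ : 1 ≤ n₀ := by
    by_contra h0
    have hst' : s = t := by omega
    subst hst'
    simp at hst
    omega
  refine ⟨i, n₀, hn₀, hi, ?_, j, s, t, hs1, hs2, ht1, ht2, hst⟩
  -- the two sub-windows of length `n₀ - 1` carry only differences `< m`
  have hlt : ∀ i' : ℕ, (i' = i ∨ i' = i + 1) → ∀ a b : ℕ, i' ≤ a → a ≤ i' + (n₀ - 1) →
      i' ≤ b → b ≤ i' + (n₀ - 1) → ∀ j' : Fin d, W.getVert b j' - W.getVert a j' < m := by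
    intro i' hi' a b ha1 ha2 hb1 hb2 j'
    by_contra hge
    push Not at hge
    exact hmin (n₀ - 1) (by omega) ⟨i', by omega, j', a, b, ha1, ha2, hb1, hb2, hge⟩
  -- one lattice step between `w_i` and `w_{i+1}`
  have hstep : ∀ j' : Fin d, W.getVert i j' - W.getVert (i + 1) j' ≤ 1 ∧
      W.getVert (i + 1) j' - W.getVert i j' ≤ 1 :=
    fun j' => coord_sub_le_one_of_adj (hH (W.adj_getVert_succ (by omega))) j'
  intro s' t' hs'1 hs'2 ht'1 ht'2 j'
  by_cases hA : i + 1 ≤ s' ∧ i + 1 ≤ t'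
  · have := hlt (i + 1) (Or.inr rfl) s' t' hA.1 (by omega) hA.2 (by omega) j'
    omega
  by_cases hB : s' ≤ i + (n₀ - 1) ∧ t' ≤ i + (n₀ - 1)
  · have := hlt i (Or.inl rfl) s' t' hs'1 hB.1 ht'1 hB.2 j'
    omega
  -- the remaining pair is `{i, i + n₀}`
  rw [not_and_or] at hA hB
  rcases Nat.lt_or_ge s' (i + 1) with hs | hs
  · have hs'i : s' = i := by omega
    have ht'e : t' = i + n₀ := by
      rcases hB with hB | hB <;> omega
    rw [hs'i, ht'e]
    have h1 := hlt (i + 1) (Or.inr rfl) (i + 1) (i + n₀) le_rfl (by omega) (by omega) (by omega) j'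
    have h2 := (hstep j').2
    omega
  · have ht'i : t' = i := by
      rcases hA with hA | hA <;> omega
    have hs'e : s' = i + n₀ := by
      rcases hB with hB | hB <;> omega
    rw [ht'i, hs'e]
    have h1 := hlt (i + 1) (Or.inr rfl) (i + n₀) (i + 1) (by omega) (by omega) le_rfl (by omega) j'
    have h2 := (hstep j').1
    omega

/-! ## Cubes and their face-to-face crossings -/

/-- The cube `a + [0, m]^d`. -/
def cube (a : Site d) (m : ℕ) : Set (Site d) := {x | ∀ j, a j ≤ x j ∧ x j ≤ a j + m}

/-- Membership in a cube, unfolded. -/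
theorem mem_cube {a : Site d} {m : ℕ} {x : Site d} :
    x ∈ cube a m ↔ ∀ j, a j ≤ x j ∧ x j ≤ a j + m := Iff.rfl

/-- **The cube lemma.** A walk in a graph of open-type steps inside `R ⊆ ℤ^d`, starting in `R`,
whose `k`-th coordinate increases by at least `m ≥ 1`, contains a sub-walk joining the two
opposite faces `{x_{k'} = a₀_{k'}}` and `{x_{k'} = a₀_{k'} + m}` of some cube `a₀ + [0,m]^d` and
staying inside that cube; every coordinate of the corner `a₀` is a coordinate of a vertex of the
walk (so `a₀` is controlled by `R`). -/
theorem exists_cubeCross_of_walk {H : SimpleGraph (Site d)} {R : Set (Site d)}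
    (hH : H ≤ withinGraph (zdGraph d) R) {u v : Site d} (hu : u ∈ R) (W : H.Walk u v)
    {m : ℕ} (hm : 1 ≤ m) {k : Fin d} (hk : (m : ℤ) ≤ v k - u k) :
    ∃ (a₀ : Site d) (k' : Fin d) (x y : Site d),
      (∀ j, ∃ z ∈ R, a₀ j = z j) ∧
      x ∈ cube a₀ m ∧ x k' = a₀ k' ∧ y ∈ cube a₀ m ∧ y k' = a₀ k' + m ∧
      (H ⊓ withinGraph (zdGraph d) (cube a₀ m)).Reachable x y := by
  classical
  have hG : H ≤ zdGraph d := hH.trans (withinGraph_le _ _)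
  obtain ⟨i, n, hn, hin, hle, j, s, t, hs1, hs2, ht1, ht2, hge⟩ := exists_window hG W hm hk
  -- the corner: coordinatewise minimum over the window
  have hne : (Finset.Icc i (i + n)).Nonempty := ⟨i, Finset.mem_Icc.2 ⟨le_rfl, by omega⟩⟩
  let a₀ : Site d := fun j' => (Finset.Icc i (i + n)).inf' hne fun r => W.getVert r j'
  have ha₀le : ∀ j' r, i ≤ r → r ≤ i + n → a₀ j' ≤ W.getVert r j' := fun j' r hr1 hr2 =>
    Finset.inf'_le (fun r => W.getVert r j') (Finset.mem_Icc.2 ⟨hr1, hr2⟩)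
  have ha₀eq : ∀ j', ∃ r, i ≤ r ∧ r ≤ i + n ∧ a₀ j' = W.getVert r j' := by
    intro j'
    obtain ⟨r, hr, hreq⟩ := Finset.exists_mem_eq_inf' hne fun r => W.getVert r j'
    exact ⟨r, (Finset.mem_Icc.1 hr).1, (Finset.mem_Icc.1 hr).2, hreq⟩
  -- every window vertex lies in the cube `a₀ + [0,m]^d`
  have hcube : ∀ r, i ≤ r → r ≤ i + n → W.getVert r ∈ cube a₀ m := by
    intro r hr1 hr2 j'
    refine ⟨ha₀le j' r hr1 hr2, ?_⟩
    obtain ⟨r', hr'1, hr'2, hr'eq⟩ := ha₀eq j'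
    rw [hr'eq]
    linarith [hle r' r hr'1 hr'2 hr1 hr2 j']
  -- the pair `(s, t)` sits on opposite `j`-faces
  have hsj : W.getVert s j = a₀ j := by
    have h1 := ha₀le j s hs1 hs2
    have h2 := (hcube t ht1 ht2 j).2
    linarith
  have htj : W.getVert t j = a₀ j + m := by
    have h2 := (hcube t ht1 ht2 j).2
    linarith [ha₀le j s hs1 hs2]
  refine ⟨a₀, j, W.getVert s, W.getVert t, fun j' => ?_, hcube s hs1 hs2, hsj, hcube t ht1 ht2,
    htj, ?_⟩
  · obtain ⟨r, -, -, hreq⟩ := ha₀eq j'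
    exact ⟨W.getVert r, getVert_mem_of_le_withinGraph hH W hu r, hreq⟩
  · -- the sub-walk between `s` and `t` stays in the window, hence in the cube
    rcases le_total s t with hst | hts
    · obtain ⟨e, rfl⟩ := Nat.exists_eq_add_of_le hst
      exact reachable_getVert_of_forall_mem hG W (cube a₀ m) s e (by omega)
        fun r hr1 hr2 => hcube r (by omega) (by omega)
    · obtain ⟨e, rfl⟩ := Nat.exists_eq_add_of_le hts
      exact (reachable_getVert_of_forall_mem hG W (cube a₀ m) t e (by omega)
        fun r hr1 hr2 => hcube r (by omega) (by omega)).symm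

end SurfaceTension

end Summit.CriticalPhenomena.PercolationContinuityZ3.Theorems

end
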